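import Summits.ValiantsHypothesis.ValiantsHypothesis.Theorems.LacunarySymmetroidMatrixDescartesChainLadder
import Summits.ValiantsHypothesis.ValiantsHypothesis.Theorems.LacunarySymmetroidMatrixDescartesCensusM3K6T30

/-!
# `MatrixDescartes` census — the CHAIN-LADDER RAYS of the certified row `M3K6T30`: `ζ_sym(3, 5(j+1)+1+i) ≥ 30(j+1) + 3·i`

HONEST FRAMING.  Object-search cell `pub-symmetroid`, crux `Theses.LacunarySymmetroid.MatrixDescartes`
(stmt-ValiantsHypothesis-18050); seat val-sym-mdr-p1 (g8).  LOWER-bound rows in census (CONJECTURE-A) currency; nothing about the crux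
`MatrixDescartes` (upper bound at fat formats), `DoorA26` / `DoorA34`, or `VP ≠ VNP`.  No definitions.

The typer's kernel certificate `Census.M3K6T30` (`ζ_sym(3,6) ≥ 30`: closed form `Census.M3K6T30.eval_det` + sign alternation at 31 rational
points) is fed — with the SAME certificate data and tactic blocks, re-checked here once — to the CHAIN LADDER in certificate form
(`Chain.not_posRootLawAt_ladder_add_of_certificate`: chaining the certificate with its own `x ↦ 1/x` reversal `j` times multiplies the
alternation count by `j+1` at the price of `5` letters per copy, and each of `i` grafted letters buys `m = 3` more), giving the
two-parameter family `ray (j i) : ¬ PosRootLawAt 3 ((j+1)·5 + 1 + i) ((j+1)·30 + i·3 − 1)` and numeral instances.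
[folklore] (intermediate value theorem; certificate arithmetic by `norm_num`, heartbeat budget as in the source certificate file).
-/

-- `Summit.ValiantsHypothesis.ValiantsHypothesis.…` repeats a component by the D-0017 layout
-- (single-conjunct summit), which the `dupNamespace` linter flags; the name is mandated.
set_option linter.dupNamespace false

namespace Summit.ValiantsHypothesis.ValiantsHypothesis.Theorems.LacunarySymmetroidMatrixDescartes.Census.Chain.RayM3K6T30

open Summit.ValiantsHypothesis.ValiantsHypothesis.Theorems.MatrixDescartes.Negative (PosRootLawAt)
open scoped BigOperators Matrix

-- 31 + 30 exact evaluations of the certificate's closed form exceed the default heartbeat budget (as in `Census.M3K6T30`).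
set_option maxHeartbeats 40000000 in
set_option exponentiation.threshold 6388 in
/-- **The chain-ladder rays of `M3K6T30`**: for every `j, i`, `ζ_sym(3, 5(j+1)+1+i) ≥ 30(j+1) + 3i` —
`¬ PosRootLawAt 3 ((j+1)·5 + 1 + i) ((j+1)·30 + i·3 − 1)` (the certified `30`-alternation row laddered `j` times and grafted `i` times).
[folklore] -/
theorem ray (j i : ℕ) : ¬ PosRootLawAt 3 ((j + 1) * 5 + 1 + i) ((j + 1) * 30 + i * 3 - 1) :=
  Summit.ValiantsHypothesis.ValiantsHypothesis.Theorems.LacunarySymmetroidMatrixDescartes.Census.Chain.not_posRootLawAt_ladder_add_of_certificate (N := 30)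
    Summit.ValiantsHypothesis.ValiantsHypothesis.Theorems.LacunarySymmetroidMatrixDescartes.Census.M3K6T30.eval_det
    (by intro l; fin_cases l <;> (unfold Matrix.IsSymm; ext i j; fin_cases i <;> fin_cases j <;> rfl))
    (![1/512, 1/256, 1/64, 11/512, 3/128, 7/256, 1/32, 23/512, 3/64, 13/256, 7/128, 1/16, 9/128, 5/64, 3/32, 7/64, 1/8, 9/64, 73/512, 37/256, 75/512, 5/32, 3/16, 107/512, 27/128, 7/32, 1/2, 2, 8, 128, 512] : Fin 31 → ℝ)
    (by
      refine Fin.strictMono_iff_lt_succ.2 fun j => ?_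
      fin_cases j <;> simp only [Fin.castSucc_mk, Fin.succ_mk] <;> norm_num)
    (by intro j; fin_cases j <;> norm_num)
    (by intro j; fin_cases j <;> simp only [Fin.castSucc_mk, Fin.succ_mk] <;> norm_num)
    (by norm_num) j i

/-- `ζ_sym(3,11) ≥ 60` (certificate `M3K6T30` laddered `1` time(s), grafted `0` time(s)). [folklore] -/
theorem row_3_11 : ¬ PosRootLawAt 3 11 59 := by
  have h := ray 1 0
  norm_num at h
  exact h

/-- `ζ_sym(3,12) ≥ 63` (certificate `M3K6T30` laddered `1` time(s), grafted `1` time(s)). [folklore] -/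
theorem row_3_12 : ¬ PosRootLawAt 3 12 62 := by
  have h := ray 1 1
  norm_num at h
  exact h

/-- `ζ_sym(3,16) ≥ 90` (certificate `M3K6T30` laddered `2` time(s), grafted `0` time(s)). [folklore] -/
theorem row_3_16 : ¬ PosRootLawAt 3 16 89 := by
  have h := ray 2 0
  norm_num at h
  exact h

end Summit.ValiantsHypothesis.ValiantsHypothesis.Theorems.LacunarySymmetroidMatrixDescartes.Census.Chain.RayM3K6T30
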